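import Summits.CriticalPhenomena.PercolationContinuityZ3.Theorems.SahiMasterFamilyFrameSandwichStep
import Summits.CriticalPhenomena.PercolationContinuityZ3.Theorems.SahiMasterFamilyFrameStep
import Summits.CriticalPhenomena.PercolationContinuityZ3.Theorems.SahiMasterFamilyShrunkFramePairwise

/-!
# The frame sandwich lemma at every order, and Sahi positivity on zero flags over an independent frame

Unit `prim-master-conj` (crux anchor stmt-CriticalPhenomena-4575); companion of `SahiMasterFamilyFrameStep.lean` (the zero-flag class on frame
cores, explicitly) and `SahiMasterFamilyFrameSandwichStep.lean` (positivity for a sandwiched member).  PROVED here: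
* `frame_sandwich_of_disjoint` — **SANDWICH_m** (PROOF-ALLK §6): if `A_0,…,A_{m−1}` are nonempty increasing events and the increasing event `D` satisfies
  `esupp(A_j) ∩ esupp(D ∩ ⋂_{l≠j} A_l) = ∅` for every `j` (the explicit zero-flag condition of `suppZeroFlag_iff_disjoint_of_frame`), then
  `D ⊇ (⋂_{l≠j} A_l) ∩ K` for every `j`, `K = {ω | ω ∪ ⋃_l esupp A_l ∈ D}` the forced-open hull — the order-`m` generalisation of the tree's
  `sandwich_left/right` (`m = 2`) and `inter_inter_hull_subset` (`m = 3`); proof by removing the supports one block at a time;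
* `sahiE_ind_nonneg_cons_cons_of_zeroFlag_frame` — consequently, **for every order**: if `(Y, A_0, …, A_{m−1})` is a zero flag of order `m + 1`
  (`SuppZeroFlag`) with `(A_l)` an independent frame, then `E_{m+2}(μ_p; 1_Y, 1_D, 1_{A_0}, …, 1_{A_{m−1}}) ≥ 0` for EVERY increasing `D` and every
  `p ∈ [0,1]^ι` — Sahi positivity (the master conjecture's positivity half) on every family whose zero-flag sub-family is "frame + one member",
  with no hypothesis of lower order (order 4 = `sahiE_four_ind_nonneg_of_zeroFlagTriple` restricted to... in fact all of it, since every `Z_3` is of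
  this form; order 5 = the type-(a) half of `sahiE_five_ind_nonneg_of_zeroFlagQuadruple`).
No conjecture asserted; axioms standard. [this work]
-/

noncomputable section

open scoped Classical

namespace Summit.CriticalPhenomena.PercolationContinuityZ3.Theorems

open Finset Function MeasureTheory
open Literature.Combinatorics.Sahi2008
open Literature.Probability.Percolation (DeterminedBy)
open Literature.Probability.LatticeModels (prodBernoulli)
open Literature.Probability.LatticeModels.Kahn2022 (Affects)
open Literature.Probability.Percolation.DecisionTree (ind ind_of_mem ind_of_not_mem ind_nonneg)

variable {ι : Type} [Fintype ι]

/-- **SANDWICH_m — the frame sandwich lemma at every order.**  Nonempty increasing `A_0,…,A_{m−1}`, increasing `D` with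
`esupp(A_j) ∩ esupp(D ∩ ⋂_{l≠j} A_l) = ∅` for every `j`; then `(⋂_{l≠j} A_l) ∩ {ω | ω ∪ ⋃_l esupp A_l ∈ D} ⊆ D` for every `j`. [this work] -/
theorem frame_sandwich_of_disjoint {m : ℕ} (A : Fin m → Set (Set ι)) (hA : ∀ j, IsUpperSet (A j)) (hne : ∀ j, (A j).Nonempty)
    {D : Set (Set ι)} (hD : IsUpperSet D)
    (hc : ∀ j, Disjoint (esupp (A j)) (esupp (D ∩ ⋂ l ∈ (univ.erase j : Finset (Fin m)), A l))) (j : Fin m) :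
    (⋂ l ∈ (univ.erase j : Finset (Fin m)), A l) ∩ {ω : Set ι | ω ∪ ↑(univ.biUnion fun l => esupp (A l)) ∈ D} ⊆ D := by
  rintro ω ⟨hωA, hωS⟩
  simp only [Set.mem_setOf_eq] at hωS
  have hωA' : ∀ l, l ≠ j → ω ∈ A l := by
    intro l hl
    simp only [Set.mem_iInter] at hωA
    exact hωA l (mem_erase.2 ⟨hl, mem_univ l⟩)
  -- removing the supports `esupp (A l)`, `l ≠ j`, one at a time
  have step : ∀ L : Finset (Fin m), L ⊆ univ.erase j →
      ω ∪ ↑(esupp (A j)) ∪ ↑(L.biUnion fun l => esupp (A l)) ∈ D → ω ∪ ↑(esupp (A j)) ∈ D := by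
    intro L
    induction L using Finset.induction_on with
    | empty => intro _ h; simpa using h
    | insert l₀ L hl₀ ih =>
      intro hL h
      have hl₀j : l₀ ≠ j := (mem_erase.1 (hL (mem_insert_self _ _))).1
      refine ih ((subset_insert _ _).trans hL) ?_
      have hψ : ω ∪ ↑(esupp (A j)) ∪ ↑(L.biUnion fun l => esupp (A l)) ∪ ↑(esupp (A l₀)) ∈
          D ∩ ⋂ l ∈ (univ.erase l₀ : Finset (Fin m)), A l := by
        refine ⟨?_, ?_⟩
        · rw [biUnion_insert, coe_union] at h
          have e : ω ∪ ↑(esupp (A j)) ∪ (↑(esupp (A l₀)) ∪ ↑(L.biUnion fun l => esupp (A l))) =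
              ω ∪ ↑(esupp (A j)) ∪ ↑(L.biUnion fun l => esupp (A l)) ∪ ↑(esupp (A l₀)) := by
            ext x; simp only [Set.mem_union]; tauto
          rwa [e] at h
        · simp only [Set.mem_iInter]
          intro l hl
          by_cases hlj : l = j
          · subst hlj
            exact mem_of_esupp_subset (hA l) (hne l) (by intro x hx; simp [hx])
          · exact (hA l) (by intro x hx; simp [hx]) (hωA' l hlj)
      exact (mem_of_union_mem_of_disjoint_esupp (hD.inter (isUpperSet_biInter_erase hA _)) (hc l₀).symm hψ).1
  have hfull : ω ∪ ↑(esupp (A j)) ∪ ↑((univ.erase j).biUnion fun l => esupp (A l)) ∈ D := by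
    have e : ω ∪ ↑(univ.biUnion fun l => esupp (A l)) =
        ω ∪ ↑(esupp (A j)) ∪ ↑((univ.erase j).biUnion fun l => esupp (A l)) := by
      conv_lhs => rw [← insert_erase (mem_univ j)]
      rw [biUnion_insert, coe_union, Set.union_assoc]
    rw [← e]; exact hωS
  have h1 : ω ∪ ↑(esupp (A j)) ∈ D ∩ ⋂ l ∈ (univ.erase j : Finset (Fin m)), A l := by
    refine ⟨step _ (Finset.Subset.refl _) hfull, ?_⟩
    simp only [Set.mem_iInter]
    intro l hl
    exact (hA l) Set.subset_union_left (hωA' l (mem_erase.1 hl).1)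
  exact (mem_of_union_mem_of_disjoint_esupp (hD.inter (isUpperSet_biInter_erase hA _)) (hc j).symm h1).1

omit [Fintype ι] in
/-- Members other than `succ i` of the family `(Y, A_0, …, A_{m−1})`. [folklore] -/
theorem biInter_erase_succ_cons {m : ℕ} (Y : Set (Set ι)) (A : Fin m → Set (Set ι)) (i : Fin m) :
    (⋂ l ∈ (univ.erase i.succ : Finset (Fin (m + 1))), (Fin.cons Y A : Fin (m + 1) → Set (Set ι)) l) =
      Y ∩ ⋂ l ∈ (univ.erase i : Finset (Fin m)), A l := by
  ext ω
  simp only [Set.mem_iInter, Set.mem_inter_iff, mem_erase, mem_univ, and_true]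
  constructor
  · intro h
    refine ⟨?_, fun l hl => ?_⟩
    · have := h 0 (Fin.succ_ne_zero i).symm
      simpa using this
    · have := h l.succ fun e => hl (Fin.succ_injective _ e)
      simpa using this
  · rintro ⟨hY, hAl⟩ l hl
    refine Fin.cases ?_ (fun l' hl' => ?_) l hl
    · intro _; simpa using hY
    · have : l' ≠ i := fun e => hl' (by rw [e])
      simpa using hAl l' this

/-- **Sahi positivity at every order on zero flags over an independent frame.**  If the increasing events `A_0,…,A_{m−1}` have pairwise disjoint
essential supports and `(Y, A_0, …, A_{m−1}) ∈ Z_{m+1}` (`SuppZeroFlag`), then for EVERY increasing event `D` and every `p ∈ [0,1]^ι`,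
`0 ≤ E_{m+2}(μ_p; 1_Y, 1_D, 1_{A_0}, …, 1_{A_{m−1}})`. [this work] -/
theorem sahiE_ind_nonneg_cons_cons_of_zeroFlag_frame (p : ι → unitInterval) {m : ℕ} (A : Fin m → Set (Set ι))
    (hA : ∀ j, IsUpperSet (A j)) (hdA : ∀ j j', j ≠ j' → Disjoint (esupp (A j)) (esupp (A j'))) {Y D : Set (Set ι)}
    (hY : IsUpperSet Y) (hD : IsUpperSet D) (hZ : SuppZeroFlag (m + 1) (Fin.cons Y A : Fin (m + 1) → Set (Set ι))) :
    0 ≤ sahiE (bernoulliWeight p) (m + 2)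
      (fun j => ind ((Fin.cons Y (Fin.cons D A : Fin (m + 1) → Set (Set ι)) : Fin (m + 2) → Set (Set ι)) j)) := by
  -- an empty frame member makes the whole functional vanish
  by_cases hne : ∀ j, (A j).Nonempty
  swap
  · push Not at hne
    obtain ⟨j, hj⟩ := hne
    exact (sahiE_ind_eq_zero_of_eq_empty p _ j.succ.succ (by simpa using hj)).symm.le
  rcases m with _ | n
  · -- no frame: `E_2(Y, D) = Cov(Y, D) ≥ 0`
    have h := sahiE_two_vec_nonneg p hY hD
    have e : (fun j => ind ((Fin.cons Y (Fin.cons D A : Fin 1 → Set (Set ι)) : Fin 2 → Set (Set ι)) j)) = ![ind Y, ind D] := by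
      funext j; fin_cases j <;> rfl
    rwa [e]
  · have hF : ∀ j, IsUpperSet ((Fin.cons Y A : Fin (n + 2) → Set (Set ι)) j) := fun j =>
      Fin.cases (by simpa using hY) (fun i => by simpa using hA i) j
    have hdis := (suppZeroFlag_iff_disjoint_of_frame (Fin.cons Y A : Fin (n + 2) → Set (Set ι)) hF 0 (by
      intro j j' hj hj' hne'
      obtain ⟨i, rfl⟩ := Fin.exists_succ_eq_of_ne_zero hj
      obtain ⟨i', rfl⟩ := Fin.exists_succ_eq_of_ne_zero hj'
      simp only [Fin.cons_succ]
      exact hdA i i' fun e => hne' (by rw [e]))).1 hZ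
    refine sahiE_ind_nonneg_cons_sandwich_cons p A hA hdA hY hD fun j =>
      frame_sandwich_of_disjoint A hA hne hY (fun i => ?_) j
    have h := hdis i.succ (Fin.succ_ne_zero i)
    rwa [Fin.cons_succ, biInter_erase_succ_cons] at h

end Summit.CriticalPhenomena.PercolationContinuityZ3.Theorems
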